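import Mathlib
import Summits.NavierStokesRegularity.NavierStokesRegularity.Theorems.L3TimeExponentPincerRingPersistenceData
import HarnessLib.Audit
import HarnessLib

/-!
# L3TimeExponentPincer — rings force LINEAR growth of every critical smoothing modulus

Support kernel for the crux `L3CascadeJaw` (item stmt-NavierStokesRegularity-19499); sequel of
`…CritModulus` (ROUND-12 of seat nsreg-p2: the scale-invariant parabolic smoothing modulus
`CritSmoothing Φ`: `‖u(t)‖_∞ ≤ √ν Φ(‖u₀‖₃/ν) t^{-1/2}` for every frame solution) and of
`…RingPersistenceData` (the ring persistence family with controlled data,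
`L3PersistenceWithData (1/2) 2`).

* `critSmoothing_linear_lower` — **if `CritSmoothing Φ` then `Φ(A) ≥ κ A` for all `A ≥ A₀`**
  (`κ, A₀ > 0` absolute).  Proof: at `ν = T = 1` the ring solution of scale `ℓ = (C₀/A)²` has
  `‖u₀‖₃ ≤ C₀ℓ^{-1/2} = A`, energy `≤ 1` and `‖u(t)‖₃ ≥ cℓ^{-1/2}` on `(0, cℓ²)`; the interpolation
  `‖u(t)‖₃³ ≤ ‖u(t)‖_∞ ∫|u(t)|²` (`eLpNorm_three_rpow_le_of_top_two`), the energy inequality and the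
  modulus at `t = cℓ²/4` give `c³ℓ^{-3/2} ≤ Φ(A) · 2/(√c ℓ)`, i.e. `Φ(A) ≥ (c^{7/2}/(2C₀)) A`.
  Kato's small-data theory has `Φ(a) = C a` near `0`; the rings say no modulus can be sublinear at
  infinity — the linear shape is forced at both ends.
* `not_critSmoothing_of_eventually_lt` — contrapositive form; `not_critSmoothing_const` — in
  particular NO CONSTANT modulus: `¬ CritSmoothing (fun _ ↦ C)`.

WHAT THIS IS NOT: not NS regularity or blow-up; a calibration of the open node `CritSmoothingB` by
explicit smooth global swirl-free solutions (it does not refute `CritSmoothingB`: `Φ(A) = CA` is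
allowed); the crux `L3CascadeJaw` is untouched; no crux claim.
-/

namespace Summit.NavierStokesRegularity.NavierStokesRegularity.Theorems.L3TimeExponentPincerCritModulusLinearLower

open Real Set MeasureTheory Literature.Analysis.FluidPDE
open Summit.NavierStokesRegularity.NavierStokesRegularity.Theorems.L3TimeExponentPincerQuantJaw
open Summit.NavierStokesRegularity.NavierStokesRegularity.Theorems.L3TimeExponentPincerCritModulus
open Summit.NavierStokesRegularity.NavierStokesRegularity.Theorems.L3TimeExponentPincerRingPersistenceData
open scoped ENNReal NNReal

/-- **Rings force linear growth of the critical smoothing modulus.**  If `CritSmoothing Φ` holds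
then there are absolute `κ, A₀ > 0` with `κ A ≤ Φ(A)` for every `A ≥ A₀`. -/
theorem critSmoothing_linear_lower {Φ : ℝ → ℝ} (hΦ : CritSmoothing Φ) :
    ∃ κ A₀ : ℝ, 0 < κ ∧ 0 < A₀ ∧ ∀ A : ℝ, A₀ ≤ A → κ * A ≤ Φ A := by
  obtain ⟨c, C₀, hc, hc1, hC₀, hfam⟩ := l3PersistenceWithData_three_half_two
  refine ⟨c ^ 3 * Real.sqrt c / (2 * C₀), C₀, by positivity, hC₀, fun A hA => ?_⟩
  have hA0 : 0 < A := hC₀.trans_le hA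
  have hsc : 0 < Real.sqrt c := Real.sqrt_pos.2 hc
  -- the scale `ℓ = (C₀/A)²`
  obtain ⟨ℓ, hℓ⟩ : ∃ ℓ : ℝ, ℓ = (C₀ / A) ^ 2 := ⟨_, rfl⟩
  have hℓ0 : 0 < ℓ := by rw [hℓ]; positivity
  have hℓ1 : ℓ ≤ 1 := by
    rw [hℓ]
    have h1 : C₀ / A ≤ 1 := by rw [div_le_one hA0]; exact hA
    have h0 : 0 ≤ C₀ / A := by positivity
    nlinarith
  have hlh : ℓ ^ (-(1 / 2 : ℝ)) = A / C₀ := by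
    rw [hℓ, Real.rpow_neg (sq_nonneg _), ← Real.sqrt_eq_rpow, Real.sqrt_sq (by positivity), inv_div]
  obtain ⟨u, pr, hF, hE, hdat, hfloor⟩ := hfam ℓ hℓ0 hℓ1
  have hdat' : eLpNorm (u 0) 3 volume ≤ ENNReal.ofReal A := by
    rw [hlh, mul_div_cancel₀ _ hC₀.ne'] at hdat
    exact hdat
  -- the time `t = s²`, `s = √c C₀²/(2A²)` (so `t = cℓ²/4`)
  obtain ⟨s, hs⟩ : ∃ s : ℝ, s = Real.sqrt c * C₀ ^ 2 / (2 * A ^ 2) := ⟨_, rfl⟩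
  have hs0 : 0 < s := by rw [hs]; positivity
  have hts : (s ^ 2) ^ (-(1 / 2 : ℝ)) = s⁻¹ := by
    rw [Real.rpow_neg (sq_nonneg _), ← Real.sqrt_eq_rpow, Real.sqrt_sq hs0.le]
  have ht_eq : s ^ 2 = c * ℓ ^ 2 / 4 := by
    rw [hs, hℓ, div_pow, mul_pow, Real.sq_sqrt hc.le]; ring
  have hℓ2 : ℓ ^ (2 : ℝ) = ℓ ^ 2 := Real.rpow_two ℓ
  have hcl : 0 < c * ℓ ^ 2 := by positivity
  have ht0 : 0 < s ^ 2 := by positivity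
  have htw : s ^ 2 ∈ Ioo 0 (c * ℓ ^ (2 : ℝ)) := ⟨ht0, by rw [hℓ2, ht_eq]; linarith⟩
  have ht1 : s ^ 2 < 1 := by
    have : c * ℓ ^ 2 ≤ 1 := by
      calc c * ℓ ^ 2 ≤ 1 * 1 := by gcongr; nlinarith
        _ = 1 := one_mul _
    rw [ht_eq]; linarith
  -- the three inputs: modulus, floor, energy
  have hsup := hΦ 1 1 A one_pos one_pos hA0.le u pr hF hdat' (s ^ 2) ⟨ht0, ht1⟩
  rw [Real.sqrt_one, one_mul, div_one] at hsup
  have hfl := hfloor (s ^ 2) htw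
  have hen : ∫⁻ x, ‖u (s ^ 2) x‖ₑ ^ 2 ≤ 1 :=
    (frame_lintegral_sq_le_energy0 zero_le_one hF ⟨ht0.le, ht1.le⟩).trans hE
  have hint := eLpNorm_three_rpow_le_of_top_two (μ := volume)
    (frame_aestronglyMeasurable hF ⟨ht0, ht1⟩) (q := 3) (by norm_num)
  rw [show (3 : ℝ) / 3 = 1 by norm_num, ENNReal.rpow_one, ENNReal.rpow_one,
    show (3 : ℝ) = ((3 : ℕ) : ℝ) by norm_num, ENNReal.rpow_natCast] at hint
  -- chain in `ℝ≥0∞`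
  have hx0 : 0 ≤ c * ℓ ^ (-(1 / 2 : ℝ)) := by positivity
  have key : ENNReal.ofReal ((c * ℓ ^ (-(1 / 2 : ℝ))) ^ 3) ≤
      ENNReal.ofReal (Φ A * (s ^ 2) ^ (-(1 / 2 : ℝ))) := by
    calc ENNReal.ofReal ((c * ℓ ^ (-(1 / 2 : ℝ))) ^ 3)
        = ENNReal.ofReal (c * ℓ ^ (-(1 / 2 : ℝ))) ^ 3 := ENNReal.ofReal_pow hx0 3
      _ ≤ eLpNorm (u (s ^ 2)) 3 volume ^ 3 := by gcongr
      _ ≤ eLpNorm (u (s ^ 2)) ⊤ volume * ∫⁻ x, ‖u (s ^ 2) x‖ₑ ^ 2 := hint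
      _ ≤ ENNReal.ofReal (Φ A) * ENNReal.ofReal ((s ^ 2) ^ (-(1 / 2 : ℝ))) * 1 := by
          gcongr
      _ = ENNReal.ofReal (Φ A * (s ^ 2) ^ (-(1 / 2 : ℝ))) := by
          rw [mul_one, ← ENNReal.ofReal_mul' (Real.rpow_nonneg ht0.le _)]
  -- back to `ℝ`
  have hpos : 0 < (c * ℓ ^ (-(1 / 2 : ℝ))) ^ 3 := by positivity
  have hreal : (c * ℓ ^ (-(1 / 2 : ℝ))) ^ 3 ≤ Φ A * (s ^ 2) ^ (-(1 / 2 : ℝ)) := by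
    rcases ENNReal.ofReal_le_ofReal_iff'.1 key with h | h
    · exact h
    · exact absurd h (not_le.2 hpos)
  rw [hts, hlh] at hreal
  have e : c ^ 3 * Real.sqrt c / (2 * C₀) * A = (c * (A / C₀)) ^ 3 * s := by
    rw [hs]; field_simp; try ring
  rw [e]
  exact (le_mul_inv_iff₀ hs0).1 hreal

/-- **No eventually-sublinear critical modulus**: if for every `κ, A₀ > 0` there is `A ≥ A₀` with
`Φ(A) < κA`, then `CritSmoothing Φ` fails. -/
theorem not_critSmoothing_of_eventually_lt {Φ : ℝ → ℝ}
    (h : ∀ κ A₀ : ℝ, 0 < κ → 0 < A₀ → ∃ A : ℝ, A₀ ≤ A ∧ Φ A < κ * A) : ¬ CritSmoothing Φ := by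
  intro hΦ
  obtain ⟨κ, A₀, hκ, hA₀, hlow⟩ := critSmoothing_linear_lower hΦ
  obtain ⟨A, hA, hlt⟩ := h κ A₀ hκ hA₀
  exact absurd (hlow A hA) (not_le.2 hlt)

/-- **No constant critical smoothing modulus**: `¬ CritSmoothing (fun _ ↦ C)` for every `C`
(a uniform bound `√t‖u(t)‖_∞ ≤ C√ν` over all Schwartz data is impossible — the viscous rings). -/
theorem not_critSmoothing_const (C : ℝ) : ¬ CritSmoothing (fun _ => C) := by
  refine not_critSmoothing_of_eventually_lt fun κ A₀ hκ hA₀ => ?_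
  refine ⟨max A₀ ((|C| + 1) / κ), le_max_left _ _, ?_⟩
  have h1 : (|C| + 1) / κ ≤ max A₀ ((|C| + 1) / κ) := le_max_right _ _
  have h2 : |C| + 1 ≤ κ * max A₀ ((|C| + 1) / κ) := by
    rw [div_le_iff₀ hκ] at h1; linarith
  linarith [le_abs_self C]

/--
info: 'Summit.NavierStokesRegularity.NavierStokesRegularity.Theorems.L3TimeExponentPincerCritModulusLinearLower.critSmoothing_linear_lower' depends on axioms: [propext,
 Classical.choice,
 Quot.sound]
-/
#guard_msgs in
#print axioms critSmoothing_linear_lower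

end Summit.NavierStokesRegularity.NavierStokesRegularity.Theorems.L3TimeExponentPincerCritModulusLinearLower
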